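import Summits.QuantumFields.QCD.Theses.PauliWegnerSea
import Summits.QuantumFields.QCD.Theorems.PauliWegnerSeaPhaseQuenchedFlavourDecayPionSecondMomentOfCrux
import Literature.MathematicalPhysics.QuantumFieldTheory.QCDPhaseQuenchedReweighting
import Literature.MathematicalPhysics.QuantumFieldTheory.QCDPhaseQuenchedPositivity
import Literature.MathematicalPhysics.QuantumFieldTheory.FermiFlavourPhase
import Literature.MathematicalPhysics.QuantumFieldTheory.QCDCurrentSector
import Literature.MathematicalPhysics.QuantumFieldTheory.QCDGoldstoneBound
import Summits.QuantumFields.QCD.Theorems.PauliWegnerSeaChiralOneScaleTrajectoryStubPionWickNumerator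
import Summits.QuantumFields.QCD.Theorems.PauliWegnerSeaChiralOneScaleTrajectoryStubChiralityTransfer
import Summits.QuantumFields.QCD.Theorems.PauliWegnerSeaChiralOneScaleTrajectoryTransferAE
import Summits.QuantumFields.QCD.Theorems.PauliWegnerSeaChiralOneScaleTrajectoryBridges
import Summits.QuantumFields.QCD.Theorems.PauliWegnerSeaChiralOneScaleTrajectoryLowerPinRates
import Summits.QuantumFields.QCD.Theorems.PauliWegnerSeaChiralOneScaleTrajectoryJensenPointwise
import Summits.QuantumFields.QCD.Theorems.PauliWegnerSeaChiralOneScaleTrajectorySignCoherence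

/-!
# RESTATEMENT PROPOSAL for crux `PauliWegnerSea.ChiralOneScaleTrajectory` (stmt-QuantumFields-17512) — lead c4-0, 2026-08-17

Evidence file for the PLANNERS (not a Theorems proposal; provers file no statement items, D-0019).  Five line leads
(-0, c1-0, c2-0, c3-0, c4-0) and the five pitem seats of stmt-QuantumFields-11513 concur that the residual of the only
line `Sketch` is the open constructive content itself.  This file makes the recommended restatement COPY-PASTE READY and
machine-checked: the two `def`s below are, byte for byte, the two REGISTERED stub signatures of skeleton v3
(`Lines/Sketch.lean`, sha256 c444eaaf…), and `chiralOneScaleTrajectory_of_honest` derives the crux BY NAME from them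
with the 15 landed support files — `lean check` rc 0, 0 sorry, standard axioms.  Filing the two `def`s as
`@[conjecture]` items (or one conditional bridge item "HonestWilsonChiralTrajectory₂ → HonestWilsonChiralTrajectory₃ →
ChiralOneScaleTrajectory", provable now by the theorem below) closes the route's bookkeeping modulo the honest open
conjecture instead of re-seating leads on a dead line.

Physics of the two leaves (why they are conjectures, not lemmas): each asserts ONE asymptotically free, mass-scaling
Wilson regularisation whose bare trajectories `m_f(k) = m_crit(k) + a_k m_f/Z_m(k)` carry, for every positive tuple,
(i) `m_f(k) > −1`, the one-scale phase-quenched localisation input, (iii) NO lattice-rate decay of the |det|-weighted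
quark propagator uniformly in the volume (light hadrons), (iv) sign coherence of `Π_f det D_W(m_f(k))` at the scheme
volume, and NoCollapse (`inf_m C₁(m,m)/s(m) = 0`: the pion becomes light with the quark — Goldstone/GMOR), plus, at
N_f = 3, superlogarithmic physical volume and the sign kernel Sign₃ at that volume.  By `Negative/CriticalMassLimsup`
the realised bare masses accumulate at `(−1,0]`; the honest witness sits on the interacting Wilson critical line
`m_c(β_k) < 0`: the chiral regime of weak-coupling lattice QCD, for which no printed proof exists.
-/

noncomputable section

namespace Summit.QuantumFields.QCD.Cruxes.ChiralOneScaleTrajectory.GoldstoneWitness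

open scoped BigOperators
open MeasureTheory Filter
open Literature.MathematicalPhysics.QuantumFieldTheory Literature.MathematicalPhysics.QuantumLattice
  Literature.Probability.LatticeModels

/-- **Proposed conjecture leaf, N_f = 2** (= registered stub `stub_packageNoCollapseTwo` of line `Sketch`, verbatim):
one two-flavour AF mass-scaling Wilson regularisation with the crux package (i)/(one-scale)/(iii)/(iv) for every positive
tuple and NoCollapse lower pins at degenerate tuples.  Open: the chiral regime of constructive lattice QCD. -/
def HonestWilsonChiralTrajectoryTwo : Prop :=
    ∃ reg : QCDRegularisation 2, reg.HasMassScaling ∧ (reg.scheme 0 0 0).HasAsymptoticScaling ∧ (∀ m : Fin 2 → ℝ, (∀ f, 0 < m f) → (∀ f : Fin 2, ∀ᶠ k in atTop, -1 < reg.mcrit k + reg.a k * m f / reg.Zm k) ∧ (∀ q : ℕ, ∃ K₀ s : ℝ, 0 < s ∧ s < 1 ∧ ∀ᶠ k in atTop, ∃ ℓ₀ : ℕ, 1 ≤ ℓ₀ ∧ ℓ₀ ≤ reg.L k ∧ (ℓ₀ : ℝ) * reg.a k ≤ K₀ * (1 + |Real.log (reg.a k)|) ∧ ∀ S : ℕ,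 reg.L k ≤ S → ∀ (f : Fin 2) (v : Literature.Probability.LatticeModels.Site 4), v ∈ box 4 S → ‖v‖ = (ℓ₀ : ℝ) → (ℓ₀ : ℝ) ^ q * (1 + |reg.β k|) ^ q * ((∫ U : GaugeConfig 4 (2 * S + 1) (Matrix.specialUnitaryGroup (Fin 3) ℂ), ‖(diracMatrix U fun fl => reg.mcrit k + reg.a k * m fl / reg.Zm k).det‖ * (∑ a : Fin 3, ∑ i : Fin 4, ∑ b : Fin 3, ∑ j : Fin 4, ‖(diracMatrix U fun fl => reg.mcrit k + reg.a k * m fl / reg.Zm k)⁻¹ (quarkEquiv (f, (Torus.proj (2 * S + 1) 0, a, i))) (quarkEquiv (f, (Torus.proj (2 * S + 1) (v), b, j)))‖) ^ s ∂(wilsonMeasure (fundamentalRep (Fin 3)) (reg.β k))) / (∫ U : GaugeConfig 4 (2 * S + 1) (Matrix.specialUnitaryGroup (Fin 3) ℂ), ‖(diracMatrix U fun fl => reg.mcrit k + reg.a k * m fl / reg.Zm k).det‖ ∂(wilsonMeasure (fundamentalRep (Fin 3)) (reg.β k)))) ≤ 1) ∧ (∃ s c₀ C₁ p : ℝ, 0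 < s ∧ s < 1 ∧ 0 < c₀ ∧ ∀ᶠ k in atTop, ∀ S : ℕ, reg.L k ≤ S → ∀ (f : Fin 2) (n : ℕ), n ≤ S → c₀ * Real.exp (-(C₁ * (reg.a k * n) + p * Real.log (n + 1))) ≤ (∫ U : GaugeConfig 4 (2 * S + 1) (Matrix.specialUnitaryGroup (Fin 3) ℂ), ‖(diracMatrix U fun fl => reg.mcrit k + reg.a k * m fl / reg.Zm k).det‖ * (∑ a : Fin 3, ∑ i : Fin 4, ∑ b : Fin 3, ∑ j : Fin 4, ‖(diracMatrix U fun fl => reg.mcrit k + reg.a k * m fl / reg.Zm k)⁻¹ (quarkEquiv (f, (Torus.proj (2 * S + 1) 0, a, i))) (quarkEquiv (f, (Torus.proj (2 * S + 1) (Pi.single 0 (n : ℤ)), b, j)))‖) ^ s ∂(wilsonMeasure (fundamentalRep (Fin 3)) (reg.β k))) / (∫ U : GaugeConfig 4 (2 * S + 1) (Matrix.specialUnitaryGroup (Fin 3) ℂ), ‖(diracMatrix U fun fl => reg.mcrit k + reg.a k * m fl / reg.Zm k).det‖ ∂(wilsonMeasure (fundamentalRep (Fin 3)) (reg.β k))))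 ∧ (∀ᶠ k in atTop, (1 / 2 : ℝ) ≤ ‖∫ U : GaugeConfig 4 (2 * reg.L k + 1) (Matrix.specialUnitaryGroup (Fin 3) ℂ), (diracMatrix U fun fl => reg.mcrit k + reg.a k * m fl / reg.Zm k).det ∂(wilsonMeasure (fundamentalRep (Fin 3)) (reg.β k))‖ / (∫ U : GaugeConfig 4 (2 * reg.L k + 1) (Matrix.specialUnitaryGroup (Fin 3) ℂ), ‖(diracMatrix U fun fl => reg.mcrit k + reg.a k * m fl / reg.Zm k).det‖ ∂(wilsonMeasure (fundamentalRep (Fin 3)) (reg.β k))))) ∧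
      ∃ f g : Fin 2, f ≠ g ∧ (∀ ε : ℝ, 0 < ε → ∃ m s c₀ C₁ p : ℝ, 0 < m ∧ 0 < s ∧ s ≤ 2 ∧ 0 < c₀ ∧ C₁ < s * ε / 2 ∧ ∀ᶠ k in atTop, ∀ S : ℕ, reg.L k ≤ S → ∀ n : ℕ, n ≤ S → c₀ * Real.exp (-(C₁ * (reg.a k * n) + p * Real.log (n + 1))) ≤ (∫ U : GaugeConfig 4 (2 * S + 1) (Matrix.specialUnitaryGroup (Fin 3) ℂ), ‖(diracMatrix U fun _ : Fin 2 => reg.mcrit k + reg.a k * m / reg.Zm k).det‖ * (∑ a : Fin 3, ∑ i : Fin 4, ∑ b : Fin 3, ∑ j : Fin 4, ‖(diracMatrix U fun _ : Fin 2 => reg.mcrit k + reg.a k * m / reg.Zm k)⁻¹ (quarkEquiv (f, (Torus.proj (2 * S + 1) 0, a, i))) (quarkEquiv (f, (Torus.proj (2 * S + 1) (Pi.single 0 (n : ℤ)), b, j)))‖) ^ s ∂(wilsonMeasure (fundamentalRep (Fin 3)) (reg.β k))) / (∫ U : GaugeConfig 4 (2 * S + 1) (Matrix.specialUnitaryGroup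 (Fin 3) ℂ), ‖(diracMatrix U fun _ : Fin 2 => reg.mcrit k + reg.a k * m / reg.Zm k).det‖ ∂(wilsonMeasure (fundamentalRep (Fin 3)) (reg.β k))))

/-- **Proposed conjecture leaf, N_f = 3** (= registered stub `stub_packageSignCoherentThree` of line `Sketch`, verbatim):
the same package for three flavours with superlogarithmic physical volume, NoCollapse, and the sign kernel Sign₃ at the
scheme volume.  Open: as above, plus sign coherence of an odd power of the Wilson determinant. -/
def HonestWilsonChiralTrajectoryThree : Prop :=
    ∃ reg : QCDRegularisation 3, reg.HasMassScaling ∧ (reg.scheme 0 0 0).HasAsymptoticScaling ∧ (∀ m : Fin 3 → ℝ, (∀ f, 0 < m f) → (∀ f : Fin 3, ∀ᶠ k in atTop, -1 < reg.mcrit k + reg.a k * m f / reg.Zm k) ∧ (∀ q : ℕ, ∃ K₀ s : ℝ, 0 < s ∧ s < 1 ∧ ∀ᶠ k in atTop, ∃ ℓ₀ : ℕ, 1 ≤ ℓ₀ ∧ ℓ₀ ≤ reg.L k ∧ (ℓ₀ : ℝ) * reg.a k ≤ K₀ * (1 + |Real.log (reg.a k)|) ∧ ∀ S : ℕ, reg.L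 k ≤ S → ∀ (f : Fin 3) (v : Literature.Probability.LatticeModels.Site 4), v ∈ box 4 S → ‖v‖ = (ℓ₀ : ℝ) → (ℓ₀ : ℝ) ^ q * (1 + |reg.β k|) ^ q * ((∫ U : GaugeConfig 4 (2 * S + 1) (Matrix.specialUnitaryGroup (Fin 3) ℂ), ‖(diracMatrix U fun fl => reg.mcrit k + reg.a k * m fl / reg.Zm k).det‖ * (∑ a : Fin 3, ∑ i : Fin 4, ∑ b : Fin 3, ∑ j : Fin 4, ‖(diracMatrix U fun fl => reg.mcrit k + reg.a k * m fl / reg.Zm k)⁻¹ (quarkEquiv (f, (Torus.proj (2 * S + 1) 0, a, i))) (quarkEquiv (f, (Torus.proj (2 * S + 1) (v), b, j)))‖) ^ s ∂(wilsonMeasure (fundamentalRep (Fin 3)) (reg.β k))) / (∫ U : GaugeConfig 4 (2 * S + 1) (Matrix.specialUnitaryGroup (Fin 3) ℂ), ‖(diracMatrix U fun fl => reg.mcrit k + reg.a k * m fl / reg.Zm k).det‖ ∂(wilsonMeasure (fundamentalRep (Fin 3)) (reg.β k)))) ≤ 1) ∧ (∃ s c₀ C₁ p : ℝ, 0 < s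 ∧ s < 1 ∧ 0 < c₀ ∧ ∀ᶠ k in atTop, ∀ S : ℕ, reg.L k ≤ S → ∀ (f : Fin 3) (n : ℕ), n ≤ S → c₀ * Real.exp (-(C₁ * (reg.a k * n) + p * Real.log (n + 1))) ≤ (∫ U : GaugeConfig 4 (2 * S + 1) (Matrix.specialUnitaryGroup (Fin 3) ℂ), ‖(diracMatrix U fun fl => reg.mcrit k + reg.a k * m fl / reg.Zm k).det‖ * (∑ a : Fin 3, ∑ i : Fin 4, ∑ b : Fin 3, ∑ j : Fin 4, ‖(diracMatrix U fun fl => reg.mcrit k + reg.a k * m fl / reg.Zm k)⁻¹ (quarkEquiv (f, (Torus.proj (2 * S + 1) 0, a, i))) (quarkEquiv (f, (Torus.proj (2 * S + 1) (Pi.single 0 (n : ℤ)), b, j)))‖) ^ s ∂(wilsonMeasure (fundamentalRep (Fin 3)) (reg.β k))) / (∫ U : GaugeConfig 4 (2 * S + 1) (Matrix.specialUnitaryGroup (Fin 3) ℂ), ‖(diracMatrix U fun fl => reg.mcrit k + reg.a k * m fl / reg.Zm k).det‖ ∂(wilsonMeasure (fundamentalRep (Fin 3)) (reg.β k)))) ∧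 (∀ᶠ k in atTop, (1 / 2 : ℝ) ≤ ‖∫ U : GaugeConfig 4 (2 * reg.L k + 1) (Matrix.specialUnitaryGroup (Fin 3) ℂ), (diracMatrix U fun fl => reg.mcrit k + reg.a k * m fl / reg.Zm k).det ∂(wilsonMeasure (fundamentalRep (Fin 3)) (reg.β k))‖ / (∫ U : GaugeConfig 4 (2 * reg.L k + 1) (Matrix.specialUnitaryGroup (Fin 3) ℂ), ‖(diracMatrix U fun fl => reg.mcrit k + reg.a k * m fl / reg.Zm k).det‖ ∂(wilsonMeasure (fundamentalRep (Fin 3)) (reg.β k))))) ∧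
      Tendsto (fun k => reg.a k * reg.L k / (1 + |Real.log (reg.a k)|)) atTop atTop ∧ ∃ f g : Fin 3, f ≠ g ∧ (∀ ε : ℝ, 0 < ε → ∃ m s c₀ C₁ p : ℝ, 0 < m ∧ 0 < s ∧ s ≤ 2 ∧ 0 < c₀ ∧ C₁ < s * ε / 2 ∧ ∀ᶠ k in atTop, ∀ S : ℕ, reg.L k ≤ S → ∀ n : ℕ, n ≤ S → c₀ * Real.exp (-(C₁ * (reg.a k * n) + p * Real.log (n + 1))) ≤ (∫ U : GaugeConfig 4 (2 * S + 1) (Matrix.specialUnitaryGroup (Fin 3) ℂ), ‖(diracMatrix U fun _ : Fin 3 => reg.mcrit k + reg.a k * m / reg.Zm k).det‖ * (∑ a : Fin 3, ∑ i : Fin 4, ∑ b : Fin 3, ∑ j : Fin 4, ‖(diracMatrix U fun _ : Fin 3 => reg.mcrit k + reg.a k * m / reg.Zm k)⁻¹ (quarkEquiv (f, (Torus.proj (2 * S + 1) 0, a, i))) (quarkEquiv (f, (Torus.proj (2 * S + 1) (Pi.single 0 (n : ℤ)), b, j)))‖) ^ s ∂(wilsonMeasure (fundamentalRep (Fin 3))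 (reg.β k))) / (∫ U : GaugeConfig 4 (2 * S + 1) (Matrix.specialUnitaryGroup (Fin 3) ℂ), ‖(diracMatrix U fun _ : Fin 3 => reg.mcrit k + reg.a k * m / reg.Zm k).det‖ ∂(wilsonMeasure (fundamentalRep (Fin 3)) (reg.β k)))) ∧ (∃ θ : ℝ, 0 < θ ∧ ∀ m : ℝ, 0 < m → ∀ᶠ k in atTop, θ * ((∫ U : GaugeConfig 4 (2 * reg.L k + 1) (Matrix.specialUnitaryGroup (Fin 3) ℂ), ‖(diracMatrix U fun _ : Fin 3 => reg.mcrit k + reg.a k * m / reg.Zm k).det‖ * (∑ a : Fin 3, ∑ i : Fin 4, ∑ b : Fin 3, ∑ j : Fin 4, ‖(diracMatrix U fun _ : Fin 3 => reg.mcrit k + reg.a k * m / reg.Zm k)⁻¹ (quarkEquiv (f, (Torus.proj (2 * reg.L k + 1) 0, a, i))) (quarkEquiv (f, (Torus.proj (2 * reg.L k + 1) (Pi.single 0 (reg.L k : ℤ)), b, j)))‖ ^ (2 : ℕ)) ∂(wilsonMeasure (fundamentalRep (Fin 3)) (reg.β k))) / (∫ U : GaugeConfig 4 (2 * reg.L k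 + 1) (Matrix.specialUnitaryGroup (Fin 3) ℂ), ‖(diracMatrix U fun _ : Fin 3 => reg.mcrit k + reg.a k * m / reg.Zm k).det‖ ∂(wilsonMeasure (fundamentalRep (Fin 3)) (reg.β k)))) ≤ ‖(∫ U : GaugeConfig 4 (2 * reg.L k + 1) (Matrix.specialUnitaryGroup (Fin 3) ℂ), (diracMatrix U fun _ : Fin 3 => reg.mcrit k + reg.a k * m / reg.Zm k).det * ((∑ a : Fin 3, ∑ i : Fin 4, ∑ b : Fin 3, ∑ j : Fin 4, ‖(diracMatrix U fun _ : Fin 3 => reg.mcrit k + reg.a k * m / reg.Zm k)⁻¹ (quarkEquiv (f, (Torus.proj (2 * reg.L k + 1) 0, a, i))) (quarkEquiv (f, (Torus.proj (2 * reg.L k + 1) (Pi.single 0 (reg.L k : ℤ)), b, j)))‖ ^ (2 : ℕ) : ℝ) : ℂ) ∂(wilsonMeasure (fundamentalRep (Fin 3)) (reg.β k))) / (∫ U : GaugeConfig 4 (2 * reg.L k + 1) (Matrix.specialUnitaryGroup (Fin 3) ℂ), (diracMatrix U fun _ : Fin 3 => reg.mcrit k + reg.a k * m / reg.Zm k).det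 ∂(wilsonMeasure (fundamentalRep (Fin 3)) (reg.β k)))‖)

/-- **The conditional bridge (provable now, proved here): the two conjecture leaves give the crux BY NAME.**
Proof = the registered composition `ChiralOneScaleTrajectory_of` of `Lines/Sketch.lean` with the stubs as hypotheses:
N_f = 2 through `frequently_violation_of_eventual_lowerPin → unsignedPin_two_of_fmPin_var → signedPin_of_unsignedPin_two →
chiralityTransfer_ae`; N_f = 3 through `signedPin_of_lowerPins_signCoh → chiralityTransfer_ae`. -/
theorem chiralOneScaleTrajectory_of_honest (h₂ : HonestWilsonChiralTrajectoryTwo)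
    (h₃ : HonestWilsonChiralTrajectoryThree) :
    Summit.QuantumFields.QCD.Theses.PauliWegnerSea.ChiralOneScaleTrajectory := by
  intro Nf hNf
  rcases hNf with rfl | rfl
  · obtain ⟨reg, hMS, hAS, hpkg, f, g, hfg, hNC⟩ := h₂
    refine ⟨reg, hMS, ?_, hAS, hpkg⟩
    refine chiralityTransfer_ae 2 f g hfg reg (signedPin_of_unsignedPin_two reg f
      (unsignedPin_two_of_fmPin_var reg f fun ε hε => ?_))
    obtain ⟨m, s, c₀, C₁, p, hm, hs, hs2, hc₀, hC₁, hev⟩ := hNC ε hε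
    refine ⟨s, m, hs, hs2, hm, ?_⟩
    exact frequently_violation_of_eventual_lowerPin reg.a reg.L (fun k S n =>
      (∫ U : GaugeConfig 4 (2 * S + 1) (Matrix.specialUnitaryGroup (Fin 3) ℂ),
          ‖(diracMatrix U fun _ : Fin 2 => reg.mcrit k + reg.a k * m / reg.Zm k).det‖ *
            (∑ a : Fin 3, ∑ i : Fin 4, ∑ b : Fin 3, ∑ j : Fin 4,
              ‖(diracMatrix U fun _ : Fin 2 => reg.mcrit k + reg.a k * m / reg.Zm k)⁻¹
                  (quarkEquiv (f, (Torus.proj (2 * S + 1) 0, a, i)))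
                  (quarkEquiv (f, (Torus.proj (2 * S + 1) (Pi.single 0 (n : ℤ)), b, j)))‖) ^ s
            ∂(wilsonMeasure (fundamentalRep (Fin 3)) (reg.β k))) /
        (∫ U : GaugeConfig 4 (2 * S + 1) (Matrix.specialUnitaryGroup (Fin 3) ℂ),
          ‖(diracMatrix U fun _ : Fin 2 => reg.mcrit k + reg.a k * m / reg.Zm k).det‖
            ∂(wilsonMeasure (fundamentalRep (Fin 3)) (reg.β k))))
      c₀ C₁ p (s * ε / 2) reg.a_pos hc₀ hC₁ hev
  · obtain ⟨reg, hMS, hAS, hpkg, hvol, f, g, hfg, hNC, hSC⟩ := h₃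
    have ha1 : ∀ᶠ k in atTop, reg.a k ≤ 1 :=
      (reg.tendsto_a.eventually (Iio_mem_nhds one_pos)).mono fun k hk => le_of_lt hk
    exact ⟨reg, hMS, chiralityTransfer_ae 3 f g hfg reg
      (signedPin_of_lowerPins_signCoh 3 (by norm_num) reg f ha1 hvol hNC hSC), hAS, hpkg⟩

/-- The bridge in the other direction is the trivial half already certified: the crux implies stmt-11513
(`oneScaleTrajectory_of_chiralOneScaleTrajectory`, p134652); it does NOT imply the leaves (NoCollapse and Sign₃ are
strictly stronger than what the crux states), so the leaves are a SUFFICIENT restatement, as every line must be. -/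
example : Summit.QuantumFields.QCD.Theses.PauliWegnerSea.ChiralOneScaleTrajectory →
    Summit.QuantumFields.QCD.Theses.PauliWegnerSea.OneScaleTrajectory :=
  oneScaleTrajectory_of_chiralOneScaleTrajectory

end Summit.QuantumFields.QCD.Cruxes.ChiralOneScaleTrajectory.GoldstoneWitness

end
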